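import Literature.Topology.FourManifolds.LinkKhSaddleChain
import Literature.Topology.FourManifolds.LinkLeeStates
import Literature.Topology.FourManifolds.LinkKhDichotomy
import HarnessLib

/-!
# Rasmussen's Prop. 4.1 for an oriented saddle: canonical generators go to canonical generators

Link tower, layer T5b. Inputs: the saddle chain map of `LinkKhSaddleChain` (T4b/2:
`saddleEntry`, `saddleMap p q h t i`, `saddleMap_apply`, `leeHomologyZeroMap`; Lee's theory is
the specialisation `(R, h, t) = (ℚ, 0, 1)` of `saddleMap_mem_leeCycles`), the circle surgery of
`LinkKhSaddle` (T4b/1: `IsSaddleMerge`, `IsSaddleSplit`, `IsSaddleMerge.surg`,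
`IsSaddleSplit.surg`), Lee's canonical states and monomials of `LinkLeeStates` (D2c:
`leeState hc t u`, `leeMonomial`, `pairCount`, `neg_one_pow_pairCount`), the persistence of
checkerboard colourings under a coherent band `IsCheckerboard.saddle (hpq : c p = c q)` of
`LinkKhDichotomy` (T1b), the abstract face algebra `KhFaces` (`Lab`, `Surg`, `upd`,
`mergeInc`, `splitInc`), the class count `KhFace.Surg.card_filter_add` of `LinkKhSaddleChain`,
and the one-circle signs `pairSign`, `leeSign` of the knot tower (`LeeRasmussenBasisProofs`,
`LeeRasmussenFaceProofs`, `LeeRasmussenTwistProofs`).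

## Statement (Rasmussen (2010), Prop. 4.1, the saddle)

For a band between coherently coloured arcs (`c p = c q`; then the Seifert state of
`L.saddle p q` is that of `L` and `leeState (hc.saddle hcpq) t u` has literally the same
labelling), the Lee saddle map `S = saddleMap p q 0 1 0` sends the canonical generator
`𝔰 = leeMonomial 0 (leeState hc t u)` to `δ • 𝔰'`, `𝔰'` the canonical generator of
`L.saddle p q` with the same `(c, t, u)`, where (normalisation of `LinkLeeStates`:
`false ↔ 𝐚 = X + 1`, `true ↔ 𝐛 = X - 1`; `e := bif c p then t else !t` is the common Lee label
of the two saddle arcs `arcOut p`, `arcOut q`):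

* **merge** of the two Seifert circles through the saddle arcs (`IsSaddleMerge p q seifertState`):
  `m(𝐚 ⊗ 𝐚) = 2𝐚`, `m(𝐛 ⊗ 𝐛) = -2𝐛`, so **`δ = 2 · leeSign e`** (`= 2` for `e = 𝐚`, `-2` for
  `e = 𝐛`): `saddleMap_leeMonomial_leeState_of_isSaddleMerge`;
* **split** of their common Seifert circle (`IsSaddleSplit`): `Δ𝐚 = 𝐚 ⊗ 𝐚`, `Δ𝐛 = 𝐛 ⊗ 𝐛`, so
  **`δ = 1`**: `saddleMap_leeMonomial_leeState_of_isSaddleSplit`;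
* packaged as `leeSaddleCoeff` (`≠ 0`, `leeSaddleCoeff_ne_zero`) in
  `saddleMap_leeMonomial_leeState`, under the hypothesis that the saddle is a merge or a split
  in the Seifert state (the `hsad` of `khovanovD_comp_saddleMap`, at one state).
* **incoherent band** (`c p ≠ c q`, not an oriented saddle): the two saddle arcs carry opposite
  Lee labels, a split is impossible and a merge multiplies `𝐚 · 𝐛 = 0`:
  `saddleMap_leeMonomial_leeState_eq_zero_of_ne` (**`S 𝔰 = 0`**, unconditionally).

The computation is done for the Lee monomial of an ARBITRARY enhanced state `s = (σ, ℓ)` in any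
homological degree (`saddleMap_leeMonomial_apply_of_isSaddleMerge`, `…_of_isSaddleSplit`,
`saddleMap_leeMonomial_eq_zero_of_isSaddleMerge_of_ne`): the column sums of the saddle matrix
against `(-1)^{pairCount}` are collapsed to the labels of the one or two saddle circles by the
new abstract lemmas `KhFace.sum_mergeInc_mul_left`, `KhFace.sum_splitInc_mul_left` (sums over
the SOURCE labellings, companions of `KhFace.sum_mergeInc_mul` / `sum_splitInc_mul`), the signs
are tracked by `neg_one_pow_pairCount_upd` (one circle relabelled) and across the surgery by
`IsSaddleMerge.pairCount_eq`, `IsSaddleSplit.pairCount_upd_add` (`Surg.card_filter_add`), and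
the remaining one-circle tables are `sum_mergeCoeff_pairSign` (`= 2 leeSign e`),
`sum_mergeCoeff_pairSign_not` (`= 0`), `sum_splitCoeff_pairSign` (`= 1`).

Corollaries: nonvanishing `saddleMap_leeMonomial_leeState_ne_zero`, the class formula on
`Kh'⁰` (`leeHomologyZeroMap_mk_leeState`), and the Hopf band of `LinkKhSaddleChain`
(`saddleMap_leeMonomial_leeState_hopfLink`: a split, `δ = 1`, by `decide`d hypotheses).

Not here: births and deaths (`LinkLeeBirthDeathCanonical`), Reidemeister moves, realisability
of `hsad` from a planar band, and the assembly of Rasmussen's Thm. 1 for links.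

## References

* J. Rasmussen, *Khovanov homology and the slice genus*, Invent. Math. 182 (2010) 419–447, §4,
  Prop. 4.1, eq. (4.1), Fig. 6. [cite: Rasmussen2010, Prop. 4.1]
* E. S. Lee, *An endomorphism of the Khovanov invariant*, Adv. Math. 197 (2005) 554–586, §4
  (`m`, `Δ` in the basis `𝐚`, `𝐛`). [cite: Lee2005, §4]
* M. Khovanov, *A categorification of the Jones polynomial*, Duke Math. J. 101 (2000), §6.3
  (the saddle). [cite: Khovanov2000, §6]
-/

open Function Finset

noncomputable section

namespace Literature.Topology.FourManifolds

open GaussDiagram (pairSign leeSign mergeCoeff splitCoeff neg_one_pow_ite_eq_pairSign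
  pairSign_mul_self neg_one_pow_eq_of_add_eq leeSign_ne_zero)

/-! ## Abstract supplements to `KhFaces`: collapsing the sums over SOURCE labellings -/

namespace KhFace

variable {X : Type*} {R : Type} [CommRing R] {h t : R}
variable {Y Y' : Type*} [DecidableEq Y] {c : X → Y} {c' : X → Y'} {α β : X}

/-- **Collapsing a merge over the source labellings.** For a merge `c → c'` uniting the classes
of `α`, `β` and a fixed labelling `mu` of the merged circles, the sum over all labellings `la`
of the old circles of `mergeInc · la mu · F la` reduces to the sum over the labels `v`, `w` of
the two merging circles (`la = mu` off them): the column of the multiplication `m` at `mu α`.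
Companion of `sum_mergeInc_mul` (which sums over the targets). Viro (2004), §5.2. [folklore] -/
theorem sum_mergeInc_mul_left [Fintype X] [DecidableEq X] [DecidableEq Y'] (S : Surg c c' α β)
    (mu : Lab c') (F : (X → Bool) → R) :
    ∑ la : Lab c, mergeInc R h t c' la.1 mu.1 α β * F la.1 =
      ∑ v : Bool, ∑ w : Bool, GaussDiagram.mergeCoeff R h t v w (mu.1 α) *
        F (upd c (upd c mu.1 β w) α v) := by
  classical
  have hba : c β ≠ c α := fun h' ↦ S.ne h'.symm
  have key : ∀ la : Lab c, mergeInc R h t c' la.1 mu.1 α β * F la.1 =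
      ∑ v : Bool, ∑ w : Bool, if la = updLab₂ S mu v w then
        GaussDiagram.mergeCoeff R h t v w (mu.1 α) * F (upd c (upd c mu.1 β w) α v) else 0 := by
    intro la
    have hla : ∀ v w, la = updLab₂ S mu v w ↔
        (la.1 = upd c (upd c mu.1 β (la.1 β)) α (la.1 α) ∧ la.1 α = v ∧ la.1 β = w) := by
      intro v w
      constructor
      · rintro rfl
        refine ⟨?_, by simp [updLab₂], by simp [updLab₂, upd_of_ne hba]⟩
        simp [updLab₂, upd_of_ne hba]
      · rintro ⟨h1, rfl, rfl⟩
        exact Subtype.ext h1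
    unfold mergeInc
    by_cases H : ∀ x, c' x ≠ c' α → mu.1 x = la.1 x
    · rw [if_pos H]
      have H' := (forall_iff_eq_upd_upd S mu la).mp fun x hx ↦ (H x hx).symm
      rw [Finset.sum_eq_single (la.1 α), Finset.sum_eq_single (la.1 β)]
      · rw [if_pos ((hla _ _).mpr ⟨H', rfl, rfl⟩), ← H']
      · intro w _ hw
        rw [if_neg]
        intro h'
        exact hw ((hla _ _).mp h').2.2.symm
      · intro h'
        exact absurd (Finset.mem_univ _) h'
      · intro v _ hv
        refine Finset.sum_eq_zero fun w _ ↦ ?_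
        rw [if_neg]
        intro h'
        exact hv ((hla _ _).mp h').2.1.symm
      · intro h'
        exact absurd (Finset.mem_univ _) h'
    · rw [if_neg H, zero_mul]
      symm
      refine Finset.sum_eq_zero fun v _ ↦ Finset.sum_eq_zero fun w _ ↦ ?_
      rw [if_neg]
      intro h'
      exact H fun x hx ↦ ((forall_iff_eq_upd_upd S mu la).mpr ((hla v w).mp h').1 x hx).symm
  simp_rw [key]
  rw [Finset.sum_comm]
  refine Finset.sum_congr rfl fun v _ ↦ ?_
  rw [Finset.sum_comm]
  refine Finset.sum_congr rfl fun w _ ↦ ?_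
  rw [Finset.sum_eq_single (updLab₂ S mu v w) (fun la _ hla ↦ if_neg hla)
    (fun h' ↦ absurd (Finset.mem_univ _) h'), if_pos rfl]

/-- **Collapsing a split over the source labellings.** For a split `c → c'` (`c` obtained from
`c'` by uniting the classes of `α`, `β`) and a fixed labelling `mu` of the split circles, the
sum over all labellings `la` of the old circles of `splitInc · la mu · F la` reduces to the sum
over the label `v` of the split circle (`la = mu` off it): the column of the comultiplication
`Δ` at `(mu α, mu β)`. Companion of `sum_splitInc_mul`. Viro (2004), §5.2. [folklore] -/
theorem sum_splitInc_mul_left [Fintype X] [DecidableEq X] (S : Surg c' c α β) (mu : Lab c')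
    (F : (X → Bool) → R) :
    ∑ la : Lab c, splitInc R h t c la.1 mu.1 α β * F la.1 =
      ∑ v : Bool, GaussDiagram.splitCoeff R h t v (mu.1 α) (mu.1 β) * F (upd c mu.1 α v) := by
  classical
  have key : ∀ la : Lab c, splitInc R h t c la.1 mu.1 α β * F la.1 =
      ∑ v : Bool, if la = updLab S mu v then
        GaussDiagram.splitCoeff R h t v (mu.1 α) (mu.1 β) * F (upd c mu.1 α v) else 0 := by
    intro la
    have hla : ∀ v, la = updLab S mu v ↔ (la.1 = upd c mu.1 α (la.1 α) ∧ la.1 α = v) := by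
      intro v
      constructor
      · rintro rfl
        exact ⟨by simp [updLab], by simp [updLab]⟩
      · rintro ⟨h1, rfl⟩
        exact Subtype.ext h1
    unfold splitInc
    by_cases H : ∀ x, c x ≠ c α → mu.1 x = la.1 x
    · rw [if_pos H]
      have H' := (forall_iff_eq_upd mu la).mp fun x hx ↦ (H x hx).symm
      rw [Finset.sum_eq_single (la.1 α)]
      · rw [if_pos ((hla _).mpr ⟨H', rfl⟩), ← H']
      · intro v _ hv
        rw [if_neg]
        intro h'
        exact hv ((hla v).mp h').2.symm
      · intro h'
        exact absurd (Finset.mem_univ _) h'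
    · rw [if_neg H, zero_mul]
      symm
      refine Finset.sum_eq_zero fun v _ ↦ ?_
      rw [if_neg]
      intro h'
      exact H fun x hx ↦ ((forall_iff_eq_upd mu la).mpr ((hla v).mp h').1 x hx).symm
  simp_rw [key]
  rw [Finset.sum_comm]
  refine Finset.sum_congr rfl fun v _ ↦ ?_
  rw [Finset.sum_eq_single (updLab S mu v) (fun la _ hla ↦ if_neg hla)
    (fun h' ↦ absurd (Finset.mem_univ _) h'), if_pos rfl]

end KhFace

namespace LinkGaussDiagram

-- As in `LinkKhSaddle` / `LinkKhSaddleChain`: `L.saddle p q` shares chords, states and arcs with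
-- `L` definitionally; reducibility lets `rw`/`simp` handle statements mixing the two diagrams.
set_option allowUnsafeReducibility true in
attribute [local reducible] LinkGaussDiagram.saddle

variable {L : LinkGaussDiagram} {p q : Fin (2 * L.n)}

/-! ## One-circle tables of `ℚ[X]/(X² - 1)` in Lee's basis, summed over the sources -/

/-- **Merge table** (sources summed): against a target label `z` of the merged circle, the two
source circles both Lee-labelled `e` contribute `∑_{v,w} m(v, w; z) s(v, e) s(w, e)`, and
`(that) · s(z, e) = 2 · leeSign e`: `m(𝐚 ⊗ 𝐚) = 2𝐚`, `m(𝐛 ⊗ 𝐛) = -2𝐛`. Lee (2005), §4.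
[cite: Lee2005, §4] -/
theorem sum_mergeCoeff_pairSign (z e : Bool) :
    (∑ v : Bool, ∑ w : Bool, mergeCoeff ℚ 0 1 v w z * pairSign v e * pairSign w e) *
      pairSign z e = 2 * leeSign e := by
  cases z <;> cases e <;> norm_num [pairSign, leeSign, mergeCoeff, Fintype.sum_bool]

/-- **Merge table, opposite labels**: `m(𝐚 ⊗ 𝐛) = 0` — against any target label the two source
circles Lee-labelled `e`, `!e` contribute `0`. Lee (2005), §4. [cite: Lee2005, §4] -/
theorem sum_mergeCoeff_pairSign_not (z e : Bool) :
    ∑ v : Bool, ∑ w : Bool, mergeCoeff ℚ 0 1 v w z * pairSign v e * pairSign w (!e) = 0 := by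
  cases z <;> cases e <;> norm_num [pairSign, mergeCoeff, Fintype.sum_bool]

/-- **Split table** (sources summed): against target labels `y`, `z` of the two new circles, the
source circle Lee-labelled `e` contributes `∑ᵥ Δ(v; y, z) s(v, e)`, and
`(that) · s(y, e) s(z, e) = 1`: `Δ𝐚 = 𝐚 ⊗ 𝐚`, `Δ𝐛 = 𝐛 ⊗ 𝐛`. Lee (2005), §4. [cite: Lee2005, §4] -/
theorem sum_splitCoeff_pairSign (y z e : Bool) :
    (∑ v : Bool, splitCoeff ℚ 0 1 v y z * pairSign v e) * pairSign y e * pairSign z e = 1 := by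
  cases y <;> cases z <;> cases e <;> norm_num [pairSign, splitCoeff, Fintype.sum_bool]

/-! ## Signs of the Lee monomials under relabelling and across the saddle surgery -/

/-- **One circle relabelled.** Putting the label `v` on the circle of `a` changes the sign
`(-1)^{pairCount σ λ ℓ}` by `s(v, ℓ a) s(λ a, ℓ a)` (all other circles contribute equally;
`λ`, `ℓ` constant on the circle of `a`). [folklore] -/
theorem neg_one_pow_pairCount_upd (σ : L.State) {lam ell : L.Arc → Bool} (a : L.Arc) (v : Bool)
    (hlam : ∀ x, L.circleOf σ x = L.circleOf σ a → lam x = lam a)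
    (hell : ∀ x, L.circleOf σ x = L.circleOf σ a → ell x = ell a) :
    (-1 : ℚ) ^ L.pairCount σ (KhFace.upd (L.circleOf σ) lam a v) ell =
      pairSign v (ell a) * pairSign (lam a) (ell a) * (-1 : ℚ) ^ L.pairCount σ lam ell := by
  have hoff : ∀ C ∈ Finset.univ.erase (L.circleOf σ a),
      (if ∃ x, L.circleOf σ x = C ∧ (!KhFace.upd (L.circleOf σ) lam a v x && ell x) = true
        then (-1 : ℚ) else 1) =
      (if ∃ x, L.circleOf σ x = C ∧ (!lam x && ell x) = true then (-1 : ℚ) else 1) := by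
    intro C hC
    rw [Finset.mem_erase] at hC
    refine if_congr ⟨?_, ?_⟩ rfl rfl
    · rintro ⟨x, rfl, hx⟩
      rw [KhFace.upd_of_ne hC.1] at hx
      exact ⟨x, rfl, hx⟩
    · rintro ⟨x, rfl, hx⟩
      refine ⟨x, rfl, ?_⟩
      rw [KhFace.upd_of_ne hC.1]
      exact hx
  have hCa : ∀ f : L.Arc → Bool, (∀ x, L.circleOf σ x = L.circleOf σ a → f x = f a) →
      (if ∃ x, L.circleOf σ x = L.circleOf σ a ∧ (!f x && ell x) = true then (-1 : ℚ) else 1) =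
        pairSign (f a) (ell a) := by
    intro f hf
    unfold GaussDiagram.pairSign
    refine if_congr ⟨?_, fun h ↦ ⟨a, rfl, h⟩⟩ rfl rfl
    rintro ⟨x, hx, h⟩
    rwa [hf x hx, hell x hx] at h
  rw [neg_one_pow_pairCount, neg_one_pow_pairCount,
    ← Finset.mul_prod_erase _ _ (Finset.mem_univ (L.circleOf σ a)),
    ← Finset.mul_prod_erase _ _ (Finset.mem_univ (L.circleOf σ a)),
    Finset.prod_congr rfl hoff, hCa (KhFace.upd (L.circleOf σ) lam a v) (fun x hx ↦ ?_),
    hCa lam hlam]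
  · rw [KhFace.upd_self, mul_assoc, ← mul_assoc (pairSign (lam a) (ell a)), pairSign_mul_self,
      one_mul]
  · rw [KhFace.upd_of_eq hx, KhFace.upd_self]

/-- **`pairCount` across a saddle-merge.** For a labelling `mu` of the circles of `L.saddle p q`
(read on `L`, whose circles refine them) and a labelling `ℓ` of the circles of `L` taking the
same value on the two saddle circles, the count over the circles of `L` exceeds that over the
circles of `L.saddle p q` by the contribution of one saddle circle (both saddle circles of `L`
and the merged circle carry the same pair of labels). [folklore] -/
theorem IsSaddleMerge.pairCount_eq {σ : L.State} (hm : L.IsSaddleMerge p q σ)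
    {mu ell : L.Arc → Bool}
    (hmu : ∀ x y, (L.saddle p q).circleOf σ x = (L.saddle p q).circleOf σ y → mu x = mu y)
    (hell : ∀ x y, L.circleOf σ x = L.circleOf σ y → ell x = ell y)
    (hab : ell (L.arcOut p) = ell (L.arcOut q)) :
    L.pairCount σ mu ell = (L.saddle p q).pairCount σ mu ell +
      if (!mu (L.arcOut p) && ell (L.arcOut p)) = true then 1 else 0 := by
  have hmuL : ∀ x y, L.circleOf σ x = L.circleOf σ y → mu x = mu y :=
    fun x y hxy ↦ hmu x y (hm.surg.le hxy)
  have hellS : ∀ x y, (L.saddle p q).circleOf σ x = (L.saddle p q).circleOf σ y →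
      ell x = ell y := by
    intro x y hxy
    rcases (hm.surg.rel x y).1 hxy with h | ⟨hx, hy⟩
    · exact hell x y h
    · have h' : ∀ z, L.circleOf σ z = L.circleOf σ (L.arcOut p) ∨
          L.circleOf σ z = L.circleOf σ (L.arcOut q) → ell z = ell (L.arcOut p) := by
        rintro z (hz | hz)
        · exact hell _ _ hz
        · exact (hell _ _ hz).trans hab.symm
      exact (h' x hx).trans (h' y hy).symm
  have hg : ∀ x y, L.circleOf σ x = L.circleOf σ y → (!mu x && ell x) = (!mu y && ell y) :=
    fun x y hxy ↦ by rw [hmuL x y hxy, hell x y hxy]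
  have hg' : ∀ x y, (L.saddle p q).circleOf σ x = (L.saddle p q).circleOf σ y →
      (!mu x && ell x) = (!mu y && ell y) :=
    fun x y hxy ↦ by rw [hmu x y hxy, hellS x y hxy]
  have key : (Finset.univ.filter fun C : L.StateCircle σ ↦
        ∃ x, L.circleOf σ x = C ∧ (!mu x && ell x) = true).card +
      (if (!mu (L.arcOut p) && ell (L.arcOut p)) = true then 1 else 0) =
      (Finset.univ.filter fun C : (L.saddle p q).StateCircle σ ↦
        ∃ x, (L.saddle p q).circleOf σ x = C ∧ (!mu x && ell x) = true).card +
      (if (!mu (L.arcOut p) && ell (L.arcOut p)) = true then 1 else 0) +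
      (if (!mu (L.arcOut q) && ell (L.arcOut q)) = true then 1 else 0) :=
    hm.surg.card_filter_add (L.circleOf_surjective σ) ((L.saddle p q).circleOf_surjective σ)
      (la := fun x ↦ !mu x && ell x) (mu := fun x ↦ !mu x && ell x) hg hg' (fun _ _ ↦ rfl)
      true
  have hb : (!mu (L.arcOut q) && ell (L.arcOut q)) = (!mu (L.arcOut p) && ell (L.arcOut p)) := by
    rw [hmu _ _ hm.surg.eq.symm, hab]
  rw [hb] at key
  unfold pairCount
  omega

/-- **Signs across a saddle-merge**: `(-1)^{pairCount_L σ μ ℓ} = s(μ a, ℓ a) (-1)^{pairCount_{L'}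
σ μ ℓ}` (`a = arcOut p`, `L' = L.saddle p q`; hypotheses of `IsSaddleMerge.pairCount_eq`).
[folklore] -/
theorem IsSaddleMerge.neg_one_pow_pairCount {σ : L.State} (hm : L.IsSaddleMerge p q σ)
    {mu ell : L.Arc → Bool}
    (hmu : ∀ x y, (L.saddle p q).circleOf σ x = (L.saddle p q).circleOf σ y → mu x = mu y)
    (hell : ∀ x y, L.circleOf σ x = L.circleOf σ y → ell x = ell y)
    (hab : ell (L.arcOut p) = ell (L.arcOut q)) :
    (-1 : ℚ) ^ L.pairCount σ mu ell = pairSign (mu (L.arcOut p)) (ell (L.arcOut p)) *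
      (-1 : ℚ) ^ (L.saddle p q).pairCount σ mu ell := by
  rw [hm.pairCount_eq hmu hell hab, pow_add, neg_one_pow_ite_eq_pairSign, mul_comm]

/-- **`pairCount` across a saddle-split.** For a labelling `mu` of the circles of `L.saddle p q`
and a labelling `ℓ` of the circles of `L`, the source labelling `mu[C_a ↦ v]` of the circles of
`L` (the split circle `C_a ∋ a = arcOut p` relabelled `v`) satisfies
`#_L(mu[C_a ↦ v]) + [μ a] + [μ b] = #_{L'}(μ) + [v]` (brackets: the predicate `λ = 1 ∧ ℓ = 𝐛`
on the respective circle; `ℓ b = ℓ a`). [folklore] -/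
theorem IsSaddleSplit.pairCount_upd_add {σ : L.State} (hsp : L.IsSaddleSplit p q σ)
    {mu ell : L.Arc → Bool}
    (hmu : ∀ x y, (L.saddle p q).circleOf σ x = (L.saddle p q).circleOf σ y → mu x = mu y)
    (hell : ∀ x y, L.circleOf σ x = L.circleOf σ y → ell x = ell y) (v : Bool) :
    L.pairCount σ (KhFace.upd (L.circleOf σ) mu (L.arcOut p) v) ell +
        (if (!mu (L.arcOut p) && ell (L.arcOut p)) = true then 1 else 0) +
        (if (!mu (L.arcOut q) && ell (L.arcOut p)) = true then 1 else 0) =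
      (L.saddle p q).pairCount σ mu ell + if (!v && ell (L.arcOut p)) = true then 1 else 0 := by
  have hellS : ∀ x y, (L.saddle p q).circleOf σ x = (L.saddle p q).circleOf σ y →
      ell x = ell y := fun x y hxy ↦ hell x y (hsp.surg.le hxy)
  have hlam : ∀ x y, L.circleOf σ x = L.circleOf σ y →
      KhFace.upd (L.circleOf σ) mu (L.arcOut p) v x =
        KhFace.upd (L.circleOf σ) mu (L.arcOut p) v y :=
    KhFace.upd_mem_lab hsp.surg ⟨mu, hmu⟩ v
  have hab : ell (L.arcOut q) = ell (L.arcOut p) :=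
    hell _ _ (circleOf_eq_iff_reachable.2 hsp.reachable).symm
  have hg' : ∀ x y, (L.saddle p q).circleOf σ x = (L.saddle p q).circleOf σ y →
      (!mu x && ell x) = (!mu y && ell y) :=
    fun x y hxy ↦ by rw [hmu x y hxy, hellS x y hxy]
  have hg : ∀ x y, L.circleOf σ x = L.circleOf σ y →
      (!KhFace.upd (L.circleOf σ) mu (L.arcOut p) v x && ell x) =
        (!KhFace.upd (L.circleOf σ) mu (L.arcOut p) v y && ell y) :=
    fun x y hxy ↦ by rw [hlam x y hxy, hell x y hxy]
  have hagree : ∀ x, L.circleOf σ x ≠ L.circleOf σ (L.arcOut p) →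
      (!KhFace.upd (L.circleOf σ) mu (L.arcOut p) v x && ell x) = (!mu x && ell x) :=
    fun x hx ↦ by rw [KhFace.upd_of_ne hx]
  have key : (Finset.univ.filter fun C : (L.saddle p q).StateCircle σ ↦
        ∃ x, (L.saddle p q).circleOf σ x = C ∧ (!mu x && ell x) = true).card +
      (if (!KhFace.upd (L.circleOf σ) mu (L.arcOut p) v (L.arcOut p) && ell (L.arcOut p)) = true
        then 1 else 0) =
      (Finset.univ.filter fun C : L.StateCircle σ ↦
        ∃ x, L.circleOf σ x = C ∧
          (!KhFace.upd (L.circleOf σ) mu (L.arcOut p) v x && ell x) = true).card +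
      (if (!mu (L.arcOut p) && ell (L.arcOut p)) = true then 1 else 0) +
      (if (!mu (L.arcOut q) && ell (L.arcOut q)) = true then 1 else 0) :=
    hsp.surg.card_filter_add ((L.saddle p q).circleOf_surjective σ) (L.circleOf_surjective σ)
      (la := fun x ↦ !mu x && ell x)
      (mu := fun x ↦ !KhFace.upd (L.circleOf σ) mu (L.arcOut p) v x && ell x) hg' hg hagree
      true
  rw [KhFace.upd_self, hab] at key
  unfold pairCount
  omega

/-- **Signs across a saddle-split**: `(-1)^{pairCount_L σ μ[C_a ↦ v] ℓ} = s(v, ℓ a) s(μ a, ℓ a)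
s(μ b, ℓ a) (-1)^{pairCount_{L'} σ μ ℓ}`. [folklore] -/
theorem IsSaddleSplit.neg_one_pow_pairCount_upd {σ : L.State} (hsp : L.IsSaddleSplit p q σ)
    {mu ell : L.Arc → Bool}
    (hmu : ∀ x y, (L.saddle p q).circleOf σ x = (L.saddle p q).circleOf σ y → mu x = mu y)
    (hell : ∀ x y, L.circleOf σ x = L.circleOf σ y → ell x = ell y) (v : Bool) :
    (-1 : ℚ) ^ L.pairCount σ (KhFace.upd (L.circleOf σ) mu (L.arcOut p) v) ell =
      pairSign v (ell (L.arcOut p)) * pairSign (mu (L.arcOut p)) (ell (L.arcOut p)) *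
        pairSign (mu (L.arcOut q)) (ell (L.arcOut p)) *
        (-1 : ℚ) ^ (L.saddle p q).pairCount σ mu ell := by
  rw [neg_one_pow_eq_of_add_eq (hsp.pairCount_upd_add hmu hell v).symm,
    neg_one_pow_ite_eq_pairSign, neg_one_pow_ite_eq_pairSign, neg_one_pow_ite_eq_pairSign]
  ring

/-! ## The saddle map on a Lee monomial: reduction to the labellings of one state -/

/-- **The saddle map on a Lee monomial, as a sum over labellings.** For any `(h, t)`, the value
of `S (leeMonomial k s)` at a state `s'` of `L.saddle p q` vanishes unless `s'` lies over the
state `σ` of `s = (σ, ℓ)`, and then it is `∑_λ S((σ, λ); s') (-1)^{pairCount σ λ ℓ}` over the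
labellings `λ` of the circles of `σ` (`sum_ite_state_eq`). [cite: Rasmussen2010, Prop. 4.1] -/
theorem saddleMap_leeMonomial_apply (h t : ℚ) (k : ℤ) (s : L.EnhancedState)
    (s' : (L.saddle p q).degStates k) :
    L.saddleMap p q h t k (L.leeMonomial k s) s' =
      if s'.1.state = s.state then
        ∑ la : KhFace.Lab (L.circleOf s.state),
          L.saddleEntry p q h t (L.ofLab s.state la) s'.1 *
            (-1 : ℚ) ^ L.pairCount s.state la.1 s.label
      else 0 := by
  have hf : ∀ u : L.EnhancedState, homDegree u ≠ k → L.saddleEntry p q h t u s'.1 *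
      (if u.state = s.state then (-1 : ℚ) ^ L.pairCount s.state u.label s.label else 0) = 0 := by
    intro u hu
    by_cases h0 : L.saddleEntry p q h t u s'.1 = 0
    · rw [h0, zero_mul]
    · exact absurd ((homDegree_eq_of_saddleEntry_ne_zero h0).symm.trans s'.2) hu
  have h1 : ∑ s₁ : L.degStates k, L.saddleEntry p q h t s₁.1 s'.1 * L.leeMonomial k s s₁ =
      ∑ u : L.EnhancedState, L.saddleEntry p q h t u s'.1 *
        (if u.state = s.state then (-1 : ℚ) ^ L.pairCount s.state u.label s.label else 0) :=
    sum_degStates_eq_sum_of_vanish k _ hf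
  rw [saddleMap_apply, h1]
  by_cases hσ : s'.1.state = s.state
  · rw [if_pos hσ]
    have h2 : ∀ u : L.EnhancedState, L.saddleEntry p q h t u s'.1 *
        (if u.state = s.state then (-1 : ℚ) ^ L.pairCount s.state u.label s.label else 0) =
        if u.state = s.state then L.saddleEntry p q h t u s'.1 *
          (-1 : ℚ) ^ L.pairCount s.state u.label s.label else 0 := fun u ↦ by
      split_ifs <;> simp
    simp_rw [h2, sum_ite_state_eq]
  · rw [if_neg hσ]
    refine Finset.sum_eq_zero fun u _ ↦ ?_
    by_cases hu : u.state = s.state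
    · rw [saddleEntry_of_ne (fun h' ↦ hσ (h'.trans hu)), zero_mul]
    · rw [if_neg hu, mul_zero]

/-- **A one-to-one bifurcation kills the Lee monomial**: if the saddle is neither a merge nor a
split in the state of `s` (virtual diagrams only), `S (leeMonomial k s) = 0` (all entries over
that state vanish). [folklore] -/
theorem saddleMap_leeMonomial_eq_zero_of_not (h t : ℚ) (k : ℤ) {s : L.EnhancedState}
    (hm : ¬ L.IsSaddleMerge p q s.state) (hsp : ¬ L.IsSaddleSplit p q s.state) :
    L.saddleMap p q h t k (L.leeMonomial k s) = 0 := by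
  funext s'
  rw [saddleMap_leeMonomial_apply, Pi.zero_apply]
  split_ifs with hσ
  · refine Finset.sum_eq_zero fun la _ ↦ ?_
    have h0 : L.saddleEntry p q h t (L.ofLab s.state la) s'.1 = 0 := by
      unfold saddleEntry
      rw [if_pos hσ, if_neg hm, if_neg hsp]
    rw [h0, zero_mul]
  · rfl

/-! ## The saddle map on a Lee monomial: merge -/

/-- **Merge, expanded.** If the saddle merges the circles `C_a ∋ a = arcOut p`,
`C_b ∋ b = arcOut q` of the state `σ` of `s = (σ, ℓ)`, then at a state `s' = (σ, μ)` of
`L.saddle p q`,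
`S(⊗ ℓ)(s') = (∑_{v,w} m(v, w; μ a) s(v, ℓ a) s(w, ℓ b)) · s(μ a, ℓ a) s(μ b, ℓ b) ·
(-1)^{pairCount_L σ μ ℓ}` (`KhFace.sum_mergeInc_mul_left`, `neg_one_pow_pairCount_upd` twice).
Lee (2005), §4. [cite: Lee2005, §4] -/
theorem saddleMap_leeMonomial_apply_of_isSaddleMerge' (k : ℤ) {s : L.EnhancedState}
    (hm : L.IsSaddleMerge p q s.state) (s' : (L.saddle p q).degStates k) :
    L.saddleMap p q 0 1 k (L.leeMonomial k s) s' =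
      if s'.1.state = s.state then
        (∑ v : Bool, ∑ w : Bool, mergeCoeff ℚ 0 1 v w (s'.1.label (L.arcOut p)) *
            pairSign v (s.label (L.arcOut p)) * pairSign w (s.label (L.arcOut q))) *
          pairSign (s'.1.label (L.arcOut p)) (s.label (L.arcOut p)) *
          pairSign (s'.1.label (L.arcOut q)) (s.label (L.arcOut q)) *
          (-1 : ℚ) ^ L.pairCount s.state s'.1.label s.label
      else 0 := by
  rw [saddleMap_leeMonomial_apply]
  by_cases hσ : s'.1.state = s.state
  swap
  · rw [if_neg hσ, if_neg hσ]
  rw [if_pos hσ, if_pos hσ]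
  have hmu' : ∀ x y, (L.saddle p q).circleOf s.state x = (L.saddle p q).circleOf s.state y →
      s'.1.label x = s'.1.label y :=
    fun x y hxy ↦ s'.1.label_eq_of_circleOf_eq (by rw [hσ]; exact hxy)
  have hmu : ∀ x y, L.circleOf s.state x = L.circleOf s.state y →
      s'.1.label x = s'.1.label y :=
    fun x y hxy ↦ hmu' x y (hm.surg.le hxy)
  have hell : ∀ x y, L.circleOf s.state x = L.circleOf s.state y → s.label x = s.label y :=
    fun x y hxy ↦ s.label_eq_of_circleOf_eq hxy
  have h1 : ∀ la : KhFace.Lab (L.circleOf s.state),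
      L.saddleEntry p q 0 1 (L.ofLab s.state la) s'.1 =
        KhFace.mergeInc ℚ 0 1 ((L.saddle p q).circleOf s.state) la.1 s'.1.label (L.arcOut p)
          (L.arcOut q) := by
    intro la
    unfold saddleEntry
    rw [if_pos hσ, if_pos hm]
  simp_rw [h1]
  rw [KhFace.sum_mergeInc_mul_left hm.surg ⟨s'.1.label, hmu'⟩
    (fun lam ↦ (-1 : ℚ) ^ L.pairCount s.state lam s.label)]
  have hpq : L.circleOf s.state (L.arcOut p) ≠ L.circleOf s.state (L.arcOut q) := hm
  have h2 : ∀ v w : Bool, (-1 : ℚ) ^ L.pairCount s.state (KhFace.upd (L.circleOf s.state)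
      (KhFace.upd (L.circleOf s.state) s'.1.label (L.arcOut q) w) (L.arcOut p) v) s.label =
      pairSign v (s.label (L.arcOut p)) * pairSign w (s.label (L.arcOut q)) *
        pairSign (s'.1.label (L.arcOut p)) (s.label (L.arcOut p)) *
        pairSign (s'.1.label (L.arcOut q)) (s.label (L.arcOut q)) *
        (-1 : ℚ) ^ L.pairCount s.state s'.1.label s.label := by
    intro v w
    rw [neg_one_pow_pairCount_upd s.state (L.arcOut p) v ?_ (fun x hx ↦ hell x _ hx),
      neg_one_pow_pairCount_upd s.state (L.arcOut q) w (fun x hx ↦ hmu x _ hx)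
        (fun x hx ↦ hell x _ hx), KhFace.upd_of_ne hpq]
    · ring
    · intro x hx
      rw [KhFace.upd_of_ne (show L.circleOf s.state x ≠ _ from fun h ↦ hpq (hx.symm.trans h)),
        KhFace.upd_of_ne hpq]
      exact hmu x _ hx
  simp only [h2, ← mul_assoc, ← Finset.sum_mul]

/-- **Merge, coherent labels (Prop. 4.1 for a merging saddle, any enhanced state).** If the
saddle merges the two circles of `s = (σ, ℓ)` through the saddle arcs and these carry the same
Lee label `e = ℓ a = ℓ b`, then `S (⊗_C ℓ(C)) = 2 · leeSign e · ⊗_{C'} ℓ(C')` over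
`L.saddle p q` (the merged circle labelled `e`): `m(𝐚 ⊗ 𝐚) = 2𝐚`, `m(𝐛 ⊗ 𝐛) = -2𝐛`.
Rasmussen (2010), Prop. 4.1; Lee (2005), §4. [cite: Rasmussen2010, Prop. 4.1] -/
theorem saddleMap_leeMonomial_apply_of_isSaddleMerge (k : ℤ) {s : L.EnhancedState}
    (hm : L.IsSaddleMerge p q s.state) (hab : s.label (L.arcOut p) = s.label (L.arcOut q))
    (s' : (L.saddle p q).degStates k) :
    L.saddleMap p q 0 1 k (L.leeMonomial k s) s' =
      if s'.1.state = s.state then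
        2 * leeSign (s.label (L.arcOut p)) *
          (-1 : ℚ) ^ (L.saddle p q).pairCount s.state s'.1.label s.label
      else 0 := by
  rw [saddleMap_leeMonomial_apply_of_isSaddleMerge' k hm s']
  split_ifs with hσ
  · have hmu' : ∀ x y, (L.saddle p q).circleOf s.state x = (L.saddle p q).circleOf s.state y →
        s'.1.label x = s'.1.label y :=
      fun x y hxy ↦ s'.1.label_eq_of_circleOf_eq (by rw [hσ]; exact hxy)
    have hell : ∀ x y, L.circleOf s.state x = L.circleOf s.state y → s.label x = s.label y :=
      fun x y hxy ↦ s.label_eq_of_circleOf_eq hxy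
    have hba : s'.1.label (L.arcOut q) = s'.1.label (L.arcOut p) := hmu' _ _ hm.surg.eq.symm
    rw [hm.neg_one_pow_pairCount hmu' hell hab, hba, ← hab]
    have h5 := sum_mergeCoeff_pairSign (s'.1.label (L.arcOut p)) (s.label (L.arcOut p))
    have h6 := pairSign_mul_self (s'.1.label (L.arcOut p)) (s.label (L.arcOut p))
    linear_combination
      (pairSign (s'.1.label (L.arcOut p)) (s.label (L.arcOut p)) *
          pairSign (s'.1.label (L.arcOut p)) (s.label (L.arcOut p)) *
          (-1 : ℚ) ^ (L.saddle p q).pairCount s.state s'.1.label s.label) * h5 +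
        (2 * leeSign (s.label (L.arcOut p)) *
          (-1 : ℚ) ^ (L.saddle p q).pairCount s.state s'.1.label s.label) * h6
  · rfl

/-- **Merge, opposite labels: `m(𝐚 ⊗ 𝐛) = 0`.** If the saddle merges the two circles of
`s = (σ, ℓ)` through the saddle arcs and these carry different Lee labels, then
`S (⊗_C ℓ(C)) = 0`. Lee (2005), §4; Rasmussen (2010), §2.3. [cite: Lee2005, §4] -/
theorem saddleMap_leeMonomial_eq_zero_of_isSaddleMerge_of_ne (k : ℤ) {s : L.EnhancedState}
    (hm : L.IsSaddleMerge p q s.state) (hab : s.label (L.arcOut p) ≠ s.label (L.arcOut q)) :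
    L.saddleMap p q 0 1 k (L.leeMonomial k s) = 0 := by
  funext s'
  rw [Pi.zero_apply, saddleMap_leeMonomial_apply_of_isSaddleMerge' k hm s']
  split_ifs with hσ
  · have hb : s.label (L.arcOut q) = !s.label (L.arcOut p) := by
      cases ha : s.label (L.arcOut p) <;> cases hb : s.label (L.arcOut q)
      · exact absurd (ha.trans hb.symm) hab
      · rfl
      · rfl
      · exact absurd (ha.trans hb.symm) hab
    rw [hb, sum_mergeCoeff_pairSign_not, zero_mul, zero_mul, zero_mul]
  · rfl

/-! ## The saddle map on a Lee monomial: split -/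

/-- **Split (Prop. 4.1 for a splitting saddle, any enhanced state).** If the saddle splits the
circle of `s = (σ, ℓ)` through the saddle arcs, then `S (⊗_C ℓ(C)) = ⊗_{C'} ℓ(C')` over
`L.saddle p q` (both new circles labelled `ℓ a`): `Δ𝐚 = 𝐚 ⊗ 𝐚`, `Δ𝐛 = 𝐛 ⊗ 𝐛`, coefficient
`1` (`KhFace.sum_splitInc_mul_left`, `IsSaddleSplit.neg_one_pow_pairCount_upd`,
`sum_splitCoeff_pairSign`). Rasmussen (2010), Prop. 4.1; Lee (2005), §4.
[cite: Rasmussen2010, Prop. 4.1] -/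
theorem saddleMap_leeMonomial_apply_of_isSaddleSplit (k : ℤ) {s : L.EnhancedState}
    (hsp : L.IsSaddleSplit p q s.state) (s' : (L.saddle p q).degStates k) :
    L.saddleMap p q 0 1 k (L.leeMonomial k s) s' =
      if s'.1.state = s.state then (-1 : ℚ) ^ (L.saddle p q).pairCount s.state s'.1.label s.label
      else 0 := by
  rw [saddleMap_leeMonomial_apply]
  by_cases hσ : s'.1.state = s.state
  swap
  · rw [if_neg hσ, if_neg hσ]
  rw [if_pos hσ, if_pos hσ]
  have hmu' : ∀ x y, (L.saddle p q).circleOf s.state x = (L.saddle p q).circleOf s.state y →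
      s'.1.label x = s'.1.label y :=
    fun x y hxy ↦ s'.1.label_eq_of_circleOf_eq (by rw [hσ]; exact hxy)
  have hell : ∀ x y, L.circleOf s.state x = L.circleOf s.state y → s.label x = s.label y :=
    fun x y hxy ↦ s.label_eq_of_circleOf_eq hxy
  have hns : ¬ L.IsSaddleMerge p q s.state := fun h ↦ h.not_isSaddleSplit hsp
  have h1 : ∀ la : KhFace.Lab (L.circleOf s.state),
      L.saddleEntry p q 0 1 (L.ofLab s.state la) s'.1 =
        KhFace.splitInc ℚ 0 1 (L.circleOf s.state) la.1 s'.1.label (L.arcOut p)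
          (L.arcOut q) := by
    intro la
    unfold saddleEntry
    rw [if_pos hσ, if_neg hns, if_pos hsp]
  simp_rw [h1]
  rw [KhFace.sum_splitInc_mul_left hsp.surg ⟨s'.1.label, hmu'⟩
    (fun lam ↦ (-1 : ℚ) ^ L.pairCount s.state lam s.label)]
  have h2 : ∀ v : Bool, (-1 : ℚ) ^ L.pairCount s.state
      (KhFace.upd (L.circleOf s.state) s'.1.label (L.arcOut p) v) s.label =
      pairSign v (s.label (L.arcOut p)) *
        pairSign (s'.1.label (L.arcOut p)) (s.label (L.arcOut p)) *
        pairSign (s'.1.label (L.arcOut q)) (s.label (L.arcOut p)) *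
        (-1 : ℚ) ^ (L.saddle p q).pairCount s.state s'.1.label s.label :=
    fun v ↦ hsp.neg_one_pow_pairCount_upd hmu' hell v
  simp only [h2, ← mul_assoc, ← Finset.sum_mul]
  rw [sum_splitCoeff_pairSign, one_mul]

/-! ## Lee's canonical states under a coherent saddle -/

section LeeStates

variable {c : Fin (2 * L.n) → Bool}

/-- The two saddle arcs of a coherent band (`c p = c q`) carry the same Lee label
`bif c p then t else !t` in every canonical state. Rasmussen (2010), §4.1, Fig. 6 (an oriented
saddle joins arcs of Seifert circles with the same label). [cite: Rasmussen2010, Prop. 4.1] -/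
theorem leeState_label_arcOut_eq_of_eq (hc : L.IsCheckerboard c) (hcpq : c p = c q) (t : Bool)
    (u : Fin L.free → Bool) :
    (L.leeState hc t u).label (L.arcOut p) = (L.leeState hc t u).label (L.arcOut q) := by
  rw [leeState_label, leeLabel_arcOut, leeLabel_arcOut, hcpq]

/-- The two saddle arcs of an incoherent band (`c p ≠ c q`) carry opposite Lee labels in every
canonical state. [cite: Rasmussen2010, Prop. 4.1] -/
theorem leeState_label_arcOut_ne_of_ne (hc : L.IsCheckerboard c) (hcpq : c p ≠ c q) (t : Bool)
    (u : Fin L.free → Bool) :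
    (L.leeState hc t u).label (L.arcOut p) ≠ (L.leeState hc t u).label (L.arcOut q) := by
  rw [leeState_label, leeLabel_arcOut, leeLabel_arcOut]
  revert hcpq
  cases c p <;> cases c q <;> cases t <;> decide

/-- **The canonical generator of the saddled diagram, unfolded.** The Seifert state and the Lee
labelling of `L.saddle p q` for `(c, t, u)` are literally those of `L` (same chords, signs and
arcs), so the Lee monomial of `leeState (hc.saddle hcpq) t u` at `s'` is
`[s'.state = seifertState] (-1)^{pairCount_{L'} seifertState s'.label (leeLabel c t u)}`.
[cite: Rasmussen2010, Prop. 4.1] -/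
theorem leeMonomial_leeState_saddle_apply (hc' : (L.saddle p q).IsCheckerboard c) (t : Bool)
    (u : Fin L.free → Bool) (k : ℤ) (s' : (L.saddle p q).degStates k) :
    (L.saddle p q).leeMonomial k ((L.saddle p q).leeState hc' t u) s' =
      if s'.1.state = L.seifertState then
        (-1 : ℚ) ^ (L.saddle p q).pairCount L.seifertState s'.1.label (L.leeLabel c t u)
      else 0 :=
  rfl

/-- **Rasmussen's Prop. 4.1 for a merging coherent saddle.** If the band joins arcs of the same
colour (`c p = c q`) lying on two different Seifert circles (`IsSaddleMerge p q seifertState`),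
the Lee saddle map sends `𝔰 = leeMonomial 0 (leeState hc t u)` to `(2 · leeSign e) • 𝔰'`,
`𝔰'` the canonical generator of `L.saddle p q` for the same `(c, t, u)` and
`e = bif c p then t else !t` the common label of the saddle arcs: `δ = 2` for `e = 𝐚`, `-2` for
`e = 𝐛`. Rasmussen (2010), Prop. 4.1. [cite: Rasmussen2010, Prop. 4.1] -/
theorem saddleMap_leeMonomial_leeState_of_isSaddleMerge (hc : L.IsCheckerboard c)
    (hcpq : c p = c q) (hm : L.IsSaddleMerge p q L.seifertState) (t : Bool)
    (u : Fin L.free → Bool) :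
    L.saddleMap p q 0 1 0 (L.leeMonomial 0 (L.leeState hc t u)) =
      (2 * leeSign (bif c p then t else !t)) •
        (L.saddle p q).leeMonomial 0 ((L.saddle p q).leeState (hc.saddle hcpq) t u) := by
  funext s'
  rw [Pi.smul_apply, smul_eq_mul, leeMonomial_leeState_saddle_apply,
    saddleMap_leeMonomial_apply_of_isSaddleMerge 0 hm (leeState_label_arcOut_eq_of_eq hc hcpq t u)
      s', mul_ite, mul_zero]
  rfl

/-- **Rasmussen's Prop. 4.1 for a splitting coherent saddle.** If the band splits one Seifert
circle (`IsSaddleSplit p q seifertState`), the Lee saddle map sends `𝔰` to `𝔰'` on the nose: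
`δ = 1`. Rasmussen (2010), Prop. 4.1. [cite: Rasmussen2010, Prop. 4.1] -/
theorem saddleMap_leeMonomial_leeState_of_isSaddleSplit (hc : L.IsCheckerboard c)
    (hcpq : c p = c q) (hsp : L.IsSaddleSplit p q L.seifertState) (t : Bool)
    (u : Fin L.free → Bool) :
    L.saddleMap p q 0 1 0 (L.leeMonomial 0 (L.leeState hc t u)) =
      (L.saddle p q).leeMonomial 0 ((L.saddle p q).leeState (hc.saddle hcpq) t u) := by
  funext s'
  rw [leeMonomial_leeState_saddle_apply, saddleMap_leeMonomial_apply_of_isSaddleSplit 0 hsp s']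
  rfl

variable (L p q) in
/-- **The saddle constant `δ` of Prop. 4.1** for the colouring `c` and the flip `t`:
`2 · leeSign (bif c p then t else !t)` (`= ±2`) if the band merges two Seifert circles, `1`
otherwise (split). [cite: Rasmussen2010, Prop. 4.1] -/
def leeSaddleCoeff (c : Fin (2 * L.n) → Bool) (t : Bool) : ℚ :=
  if L.IsSaddleMerge p q L.seifertState then 2 * leeSign (bif c p then t else !t) else 1

/-- **The saddle constant is nonzero** (`±2` or `1`). [cite: Rasmussen2010, Prop. 4.1] -/
theorem leeSaddleCoeff_ne_zero (c : Fin (2 * L.n) → Bool) (t : Bool) :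
    L.leeSaddleCoeff p q c t ≠ 0 := by
  unfold leeSaddleCoeff
  split_ifs
  · exact mul_ne_zero two_ne_zero (leeSign_ne_zero _)
  · exact one_ne_zero

/-- **Rasmussen's Prop. 4.1 for a coherent saddle.** For a checkerboard-coloured diagram and a
band between arcs of the same colour which is a merge or a split in the Seifert state (the
realisability input `hsad` of `khovanovD_comp_saddleMap`, at that one state), the Lee saddle
map sends the canonical generator `𝔰 = leeMonomial 0 (leeState hc t u)` to the NONZERO
multiple `leeSaddleCoeff • 𝔰'` of the canonical generator of `L.saddle p q` for the same
`(c, t, u)` (`leeSaddleCoeff_ne_zero`; `δ = ±2` at a merge, `1` at a split).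
Rasmussen (2010), Prop. 4.1. [cite: Rasmussen2010, Prop. 4.1] -/
theorem saddleMap_leeMonomial_leeState (hc : L.IsCheckerboard c) (hcpq : c p = c q)
    (hsad : L.IsSaddleMerge p q L.seifertState ∨ L.IsSaddleSplit p q L.seifertState)
    (t : Bool) (u : Fin L.free → Bool) :
    L.saddleMap p q 0 1 0 (L.leeMonomial 0 (L.leeState hc t u)) =
      L.leeSaddleCoeff p q c t •
        (L.saddle p q).leeMonomial 0 ((L.saddle p q).leeState (hc.saddle hcpq) t u) := by
  unfold leeSaddleCoeff
  by_cases hm : L.IsSaddleMerge p q L.seifertState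
  · rw [if_pos hm]
    exact saddleMap_leeMonomial_leeState_of_isSaddleMerge hc hcpq hm t u
  · rw [if_neg hm, one_smul]
    exact saddleMap_leeMonomial_leeState_of_isSaddleSplit hc hcpq (hsad.resolve_left hm) t u

/-- **The image of the canonical generator under a coherent saddle is nonzero.**
[cite: Rasmussen2010, Prop. 4.1] -/
theorem saddleMap_leeMonomial_leeState_ne_zero (hc : L.IsCheckerboard c) (hcpq : c p = c q)
    (hsad : L.IsSaddleMerge p q L.seifertState ∨ L.IsSaddleSplit p q L.seifertState)
    (t : Bool) (u : Fin L.free → Bool) :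
    L.saddleMap p q 0 1 0 (L.leeMonomial 0 (L.leeState hc t u)) ≠ 0 := by
  rw [saddleMap_leeMonomial_leeState hc hcpq hsad t u]
  exact smul_ne_zero (L.leeSaddleCoeff_ne_zero c t)
    (leeMonomial_leeState_ne_zero (hc.saddle hcpq) t u)

/-- **An incoherent band kills the canonical generator.** If `c p ≠ c q` the two saddle arcs
carry opposite Lee labels in `leeState hc t u`; they cannot lie on one Seifert circle, so the
saddle is not a split, and if it is a merge it multiplies `𝐚 · 𝐛 = 0` (if it is neither, the
map vanishes over the Seifert state anyway): `S 𝔰 = 0`. (Such a band is not an oriented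
saddle; cf. `IsCheckerboard.apply_eq_of_saddle`.) Lee (2005), §4; Rasmussen (2010), §2.3.
[cite: Lee2005, §4] -/
theorem saddleMap_leeMonomial_leeState_eq_zero_of_ne (hc : L.IsCheckerboard c)
    (hcpq : c p ≠ c q) (t : Bool) (u : Fin L.free → Bool) :
    L.saddleMap p q 0 1 0 (L.leeMonomial 0 (L.leeState hc t u)) = 0 := by
  have hab := leeState_label_arcOut_ne_of_ne hc hcpq t u
  by_cases hm : L.IsSaddleMerge p q L.seifertState
  · exact saddleMap_leeMonomial_eq_zero_of_isSaddleMerge_of_ne 0 hm hab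
  · have hsp : ¬ L.IsSaddleSplit p q L.seifertState := fun hsp ↦
      hab ((L.leeState hc t u).label_eq_of_circleOf_eq
        (circleOf_eq_iff_reachable.2 hsp.reachable))
    exact saddleMap_leeMonomial_eq_zero_of_not 0 1 0 hm hsp

/-! ## On Lee homology in degree zero -/

/-- **Prop. 4.1 for a coherent saddle on `Kh'⁰`.** Under the merge-or-split hypotheses of
`leeHomologyZeroMap` (`LinkKhSaddleChain`), the induced map sends the class `[𝔰]` of the
canonical generator to `leeSaddleCoeff • [𝔰']`. Rasmussen (2010), Prop. 4.1, §4.2.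
[cite: Rasmussen2010, Prop. 4.1] -/
theorem leeHomologyZeroMap_mk_leeState
    (hms : ∀ (σ : L.State) (k : Fin L.n), σ k = false → L.IsMergeAt σ k ∨ L.IsSplitAt σ k)
    (hms' : ∀ (σ : L.State) (k : Fin L.n), σ k = false →
      (L.saddle p q).IsMergeAt σ k ∨ (L.saddle p q).IsSplitAt σ k)
    (hsad : ∀ σ : L.State, L.IsSaddleMerge p q σ ∨ L.IsSaddleSplit p q σ)
    (hc : L.IsCheckerboard c) (hcpq : c p = c q) (t : Bool) (u : Fin L.free → Bool) :
    L.leeHomologyZeroMap p q hms hms' hsad (Submodule.Quotient.mk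
        ⟨L.leeMonomial 0 (L.leeState hc t u), leeMonomial_leeState_mem_leeCycles hc t u⟩) =
      L.leeSaddleCoeff p q c t • Submodule.Quotient.mk
        ⟨(L.saddle p q).leeMonomial 0 ((L.saddle p q).leeState (hc.saddle hcpq) t u),
          leeMonomial_leeState_mem_leeCycles (hc.saddle hcpq) t u⟩ := by
  have key : (⟨L.saddleMap p q 0 1 0 (L.leeMonomial 0 (L.leeState hc t u)),
      L.saddleMap_mem_leeCycles p q hms hms' hsad (leeMonomial_leeState_mem_leeCycles hc t u)⟩ :
        (L.saddle p q).leeCycles) =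
      L.leeSaddleCoeff p q c t •
        ⟨(L.saddle p q).leeMonomial 0 ((L.saddle p q).leeState (hc.saddle hcpq) t u),
          leeMonomial_leeState_mem_leeCycles (hc.saddle hcpq) t u⟩ :=
    Subtype.ext (saddleMap_leeMonomial_leeState hc hcpq (hsad _) t u)
  rw [leeHomologyZeroMap_mk]
  exact congrArg Submodule.Quotient.mk key

end LeeStates

/-! ## Sanity: the oriented band on the Hopf link -/

/-- The Seifert state of the positive Hopf link is the all-`0` state (both crossings positive).
[folklore] -/
theorem seifertState_hopfLink : hopfLink.seifertState = fun _ ↦ false := by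
  funext i
  rfl

/-- **Sanity (Hopf band).** The oriented band of `LinkKhSaddleChain` on the Hopf link (arcs
leaving `1` and `2`, equal colours under `isCheckerboard_hopfLink`) splits the Seifert circle
structure (`hopfLink_band_isSaddleSplit`), so its Lee saddle map sends each canonical generator
`𝔰_t` to the canonical generator of the saddled diagram with coefficient `δ = 1`.
[cite: Rasmussen2010, Prop. 4.1] -/
theorem saddleMap_leeMonomial_leeState_hopfLink (t : Bool) :
    hopfLink.saddleMap hopfPt1 hopfPt2 0 1 0
        (hopfLink.leeMonomial 0 (hopfLink.leeState isCheckerboard_hopfLink t Fin.elim0)) =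
      (hopfLink.saddle hopfPt1 hopfPt2).leeMonomial 0
        ((hopfLink.saddle hopfPt1 hopfPt2).leeState
          (isCheckerboard_hopfLink.saddle (p := hopfPt1) (q := hopfPt2) rfl) t Fin.elim0) :=
  saddleMap_leeMonomial_leeState_of_isSaddleSplit (p := hopfPt1) (q := hopfPt2)
    isCheckerboard_hopfLink rfl
    (by rw [seifertState_hopfLink]; exact hopfLink_band_isSaddleSplit) t Fin.elim0

/-- On the Hopf band the packaged constant is `δ = 1` (a split). [cite: Rasmussen2010, Prop. 4.1] -/
theorem leeSaddleCoeff_hopfLink (t : Bool) :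
    hopfLink.leeSaddleCoeff hopfPt1 hopfPt2 ![true, false, false, true] t = 1 := by
  unfold leeSaddleCoeff
  rw [seifertState_hopfLink, if_neg fun hm ↦ hm.not_isSaddleSplit hopfLink_band_isSaddleSplit]

end LinkGaussDiagram

end Literature.Topology.FourManifolds

end
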